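import Mathlib
import Summits.KontsevichZagierPeriods.KontsevichZagierPeriods.Theses.SymplecticScissors
import Literature.NumberTheory.Transcendental.KZCalculusProofs
import Literature.NumberTheory.Transcendental.SemialgebraicMapsProofs
import Literature.NumberTheory.Transcendental.KZLogCalculusProofs

/-!
# `VolumeForm` (stmt-KontsevichZagierPeriods-3814), line `Sketch` — stub `stub_polyStackUnconditional`

THE UNCONDITIONAL THEOREM of the ruled-stacks line, as glue: Hilbert's third problem has no
obstruction in the Kontsevich–Zagier calculus for polynomial ruled solids. Two finite disjoint unions
of POLYNOMIAL triangular stacks in `ℝ³` (solids swept over a rational interval `(a, b)` by open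
non-degenerate triangles whose vertices are `ℚ`-polynomial curves of the sweep parameter, integrand
`1`) with EQUAL VOLUME are KZ-equivalent — with no transcendence input.

Hypotheses (neighbouring stubs of the skeleton, taken here as assumptions): `HEIGHT` — such a union
`r` is KZ-equivalent to the planar integrand-`1` subgraph `s` of a non-negative `ℚ`-polynomial `Q` over
`(a, b)`; `PRIM` — the planar subgraph of `f ≥ 0` with a `ℚ`-semialgebraic primitive `F` on `[a, b]`
is KZ-equivalent to the point representation `c` (dimension `0`, domain `ℝ⁰`) with constant
`F b − F a`.

Proof (this file): take the polynomial primitive `G ∈ ℚ[X]` of `Q` (`G' = Q`,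
`polyUnc_exists_derivative_eq`), so `r ∼ s ∼ c = [pt, G(b) − G(a)]`, and likewise
`r' ∼ s' ∼ c' = [pt, G'(b') − G'(a')]`. By soundness of the calculus (`KZ.Equivalent.value_eq_holds`)
and `vol(ℝ⁰) = 1` the two constants are `r.value = r'.value`, hence equal, and two point
representations with the same constant differ by one integrand-additivity move
(`KZ.of_sub_of_mem_relations_of_eqOn`).

Sources: M. Kontsevich, D. Zagier, *Periods* (2001), §1.2 (rules (1)–(3), soundness);
J. Cresson, J. Viu-Sos, *On the equality of periods of Kontsevich–Zagier* (2022), §4 (polytope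
sector); the rest is bookkeeping (folklore).
-/

noncomputable section

open scoped BigOperators
open Set MeasureTheory
open Literature.NumberTheory.Transcendental

namespace Summit.KontsevichZagierPeriods.SymplecticScissors.VolumeForm

/-! ## Helpers -/

/-- Every rational polynomial has a rational primitive: `Q = G′` with
`G = Σₙ qₙ X^{n+1}/(n+1) ∈ ℚ[X]`. [folklore] -/
theorem polyUnc_exists_derivative_eq (Q : Polynomial ℚ) :
    ∃ G : Polynomial ℚ, Polynomial.derivative G = Q := by
  -- adapted from Theorems/HermiteRigidityEllipticMomentKernelStubPolynomialPart.lean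
  induction Q using Polynomial.induction_on' with
  | add p q hp hq =>
    obtain ⟨Gp, hGp⟩ := hp
    obtain ⟨Gq, hGq⟩ := hq
    exact ⟨Gp + Gq, by rw [Polynomial.derivative_add, hGp, hGq]⟩
  | monomial n c =>
    refine ⟨Polynomial.monomial (n + 1) (c / ((n : ℚ) + 1)), ?_⟩
    rw [Polynomial.derivative_monomial_succ, div_mul_cancel₀ c (Nat.cast_add_one_ne_zero n)]

/-- The open interval `(a, b) ⊆ ℝ¹` with rational endpoints (first-coordinate spelling) is
`ℚ`-semialgebraic: two strict polynomial inequalities. [folklore] -/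
theorem polyUnc_isSemialgebraic_Ioo (a b : ℚ) :
    Literature.ModelTheory.ExponentialFields.IsSemialgebraic ℚ
      {z : Fin 1 → ℝ | z 0 ∈ Set.Ioo (a : ℝ) b} := by
  -- adapted from Literature/NumberTheory/Transcendental/KZBallPeelingAux.lean `isSemialgebraic_Ioo₁`
  have hset : {z : Fin 1 → ℝ | z 0 ∈ Set.Ioo (a : ℝ) b} =
      {z | MvPolynomial.aeval z (MvPolynomial.C a : MvPolynomial (Fin 1) ℚ) <
          MvPolynomial.aeval z (MvPolynomial.X 0 : MvPolynomial (Fin 1) ℚ)} ∩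
        {z | MvPolynomial.aeval z (MvPolynomial.X 0 : MvPolynomial (Fin 1) ℚ) <
          MvPolynomial.aeval z (MvPolynomial.C b : MvPolynomial (Fin 1) ℚ)} := by
    ext z
    simp
  rw [hset]
  exact (Literature.ModelTheory.ExponentialFields.isSemialgebraic_setOf_eval_lt _ _).inter
    (Literature.ModelTheory.ExponentialFields.isSemialgebraic_setOf_eval_lt _ _)

/-- The closed interval `[a, b] ⊆ ℝ¹` with rational endpoints (first-coordinate spelling) is
`ℚ`-semialgebraic: two non-strict polynomial inequalities. [folklore] -/
theorem polyUnc_isSemialgebraic_Icc (a b : ℚ) :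
    Literature.ModelTheory.ExponentialFields.IsSemialgebraic ℚ
      {z : Fin 1 → ℝ | z 0 ∈ Set.Icc (a : ℝ) b} := by
  have hset : {z : Fin 1 → ℝ | z 0 ∈ Set.Icc (a : ℝ) b} =
      {z | MvPolynomial.aeval z (MvPolynomial.C a : MvPolynomial (Fin 1) ℚ) ≤
          MvPolynomial.aeval z (MvPolynomial.X 0 : MvPolynomial (Fin 1) ℚ)} ∩
        {z | MvPolynomial.aeval z (MvPolynomial.X 0 : MvPolynomial (Fin 1) ℚ) ≤
          MvPolynomial.aeval z (MvPolynomial.C b : MvPolynomial (Fin 1) ℚ)} := by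
    ext z
    simp
  rw [hset]
  exact (Literature.ModelTheory.ExponentialFields.isSemialgebraic_setOf_eval_le _ _).inter
    (Literature.ModelTheory.ExponentialFields.isSemialgebraic_setOf_eval_le _ _)

/-- A rational polynomial in the first coordinate, `z ↦ p (z 0)`, is a `ℚ`-semialgebraic function on
every `ℚ`-semialgebraic subset of `ℝ¹` (it is the evaluation of the `MvPolynomial` `p (X 0)`).
[cite: BochnakCosteRoy1998, Prop. 2.2.6] -/
theorem polyUnc_isSemialgebraicFunOn_aeval {s : Set (Fin 1 → ℝ)}
    (hs : Literature.ModelTheory.ExponentialFields.IsSemialgebraic ℚ s) (p : Polynomial ℚ) :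
    IsSemialgebraicFunOn ℚ s (fun z => (Polynomial.aeval (z 0) p : ℝ)) := by
  refine (isSemialgebraicFunOn_aeval hs
    (Polynomial.aeval (MvPolynomial.X 0 : MvPolynomial (Fin 1) ℚ) p)).congr fun z _ => ?_
  simp only
  rw [← Polynomial.aeval_algHom_apply, MvPolynomial.aeval_X]

/-- The value of a point representation (dimension `0`, domain `ℝ⁰ = {pt}`, constant integrand `C`)
is its constant: `vol(ℝ⁰) = 1`. [Kontsevich–Zagier 2001, §1.1 (constants)] [folklore] -/
theorem polyUnc_value_eq_const (c : KZ.IntegralRep 0) {C : ℝ} (hcd : c.domain = Set.univ)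
    (hci : ∀ x, c.integrand x = C) : c.value = C := by
  have hvol : (volume : Measure (Fin 0 → ℝ)) Set.univ = 1 := by
    rw [volume_pi, Measure.pi_univ]
    simp
  have hi : c.integrand = fun _ => C := funext hci
  rw [KZ.IntegralRep.value, hcd, Measure.restrict_univ, hi, integral_const, smul_eq_mul]
  simp [Measure.real, hvol]

/-! ## The stub -/

/-- **Polynomial stacks are unconditional** (glue): given `PRIM` (semialgebraic primitives land a
planar subgraph in dimension zero) and `HEIGHT` (a finite disjoint union of polynomial triangular
stacks is KZ-equivalent to the planar subgraph of a non-negative `ℚ`-polynomial), two finite disjoint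
unions of polynomial triangular stacks of equal volume are KZ-equivalent: reduce both to planar
subgraphs of `Q, Q' ∈ ℚ[X]`, integrate once more with the polynomial primitives `G, G'` onto the
point representations `[pt, G(b) − G(a)]`, `[pt, G'(b') − G'(a')]`, whose constants are the two
(equal) volumes by soundness, and two point representations with the same constant differ by a
relation. No transcendence input. [Kontsevich–Zagier 2001, §1.2; Cresson–Viu-Sos 2022, §4; folklore] -/
theorem stub_polyStackUnconditional :
    (∀ (a b : ℚ) (f F : ℝ → ℝ) (s : KZ.IntegralRep 2),
      a < b →
      IsSemialgebraicFunOn ℚ {z : Fin 1 → ℝ | z 0 ∈ Set.Ioo (a : ℝ) b} (fun z => f (z 0)) →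
      IsSemialgebraicFunOn ℚ {z : Fin 1 → ℝ | z 0 ∈ Set.Icc (a : ℝ) b} (fun z => F (z 0)) →
      ContinuousOn F (Set.Icc (a : ℝ) b) →
      (∀ t ∈ Set.Ioo (a : ℝ) b, HasDerivAt F (f t) t) →
      (∀ t ∈ Set.Ioo (a : ℝ) b, 0 ≤ f t) →
      s.domain = {q | q 0 ∈ Set.Ioo (a : ℝ) b ∧ 0 < q 1 ∧ q 1 < f (q 0)} →
      (∀ q ∈ s.domain, s.integrand q = 1) →
      ∃ c : KZ.IntegralRep 0, c.domain = Set.univ ∧ (∀ x, c.integrand x = F b - F a) ∧ KZ.Equivalent s c) →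
    (∀ (k : ℕ) (a b : ℚ) (P : Fin k → Fin 3 → Fin 2 → Polynomial ℚ) (r : KZ.IntegralRep 3),
      a < b →
      (∀ i, ∀ t ∈ Set.Ioo (a : ℝ) b,
          (Polynomial.aeval t (P i 1 0) - Polynomial.aeval t (P i 0 0)) *
            (Polynomial.aeval t (P i 2 1) - Polynomial.aeval t (P i 0 1)) -
          (Polynomial.aeval t (P i 1 1) - Polynomial.aeval t (P i 0 1)) *
            (Polynomial.aeval t (P i 2 0) - Polynomial.aeval t (P i 0 0)) ≠ 0) →
      (∀ i i', i ≠ i' → Disjoint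
        {p : Fin 3 → ℝ | p 0 ∈ Set.Ioo (a : ℝ) b ∧ ∃ l m : ℝ, 0 < l ∧ 0 < m ∧ l + m < 1 ∧
            p 1 = Polynomial.aeval (p 0) (P i 0 0) + l * (Polynomial.aeval (p 0) (P i 1 0) - Polynomial.aeval (p 0) (P i 0 0)) +
              m * (Polynomial.aeval (p 0) (P i 2 0) - Polynomial.aeval (p 0) (P i 0 0)) ∧
            p 2 = Polynomial.aeval (p 0) (P i 0 1) + l * (Polynomial.aeval (p 0) (P i 1 1) - Polynomial.aeval (p 0) (P i 0 1)) +
              m * (Polynomial.aeval (p 0) (P i 2 1) - Polynomial.aeval (p 0) (P i 0 1))}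
        {p : Fin 3 → ℝ | p 0 ∈ Set.Ioo (a : ℝ) b ∧ ∃ l m : ℝ, 0 < l ∧ 0 < m ∧ l + m < 1 ∧
            p 1 = Polynomial.aeval (p 0) (P i' 0 0) + l * (Polynomial.aeval (p 0) (P i' 1 0) - Polynomial.aeval (p 0) (P i' 0 0)) +
              m * (Polynomial.aeval (p 0) (P i' 2 0) - Polynomial.aeval (p 0) (P i' 0 0)) ∧
            p 2 = Polynomial.aeval (p 0) (P i' 0 1) + l * (Polynomial.aeval (p 0) (P i' 1 1) - Polynomial.aeval (p 0) (P i' 0 1)) +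
              m * (Polynomial.aeval (p 0) (P i' 2 1) - Polynomial.aeval (p 0) (P i' 0 1))}) →
      r.domain = ⋃ i, {p : Fin 3 → ℝ | p 0 ∈ Set.Ioo (a : ℝ) b ∧ ∃ l m : ℝ, 0 < l ∧ 0 < m ∧ l + m < 1 ∧
            p 1 = Polynomial.aeval (p 0) (P i 0 0) + l * (Polynomial.aeval (p 0) (P i 1 0) - Polynomial.aeval (p 0) (P i 0 0)) +
              m * (Polynomial.aeval (p 0) (P i 2 0) - Polynomial.aeval (p 0) (P i 0 0)) ∧
            p 2 = Polynomial.aeval (p 0) (P i 0 1) + l * (Polynomial.aeval (p 0) (P i 1 1) - Polynomial.aeval (p 0) (P i 0 1)) +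
              m * (Polynomial.aeval (p 0) (P i 2 1) - Polynomial.aeval (p 0) (P i 0 1))} →
      (∀ p ∈ r.domain, r.integrand p = 1) →
      ∃ (Q : Polynomial ℚ) (s : KZ.IntegralRep 2),
        (∀ t ∈ Set.Ioo (a : ℝ) b, 0 ≤ Polynomial.aeval t Q) ∧
        s.domain = {q | q 0 ∈ Set.Ioo (a : ℝ) b ∧ 0 < q 1 ∧ q 1 < Polynomial.aeval (q 0) Q} ∧
        (∀ q ∈ s.domain, s.integrand q = 1) ∧ KZ.Equivalent r s) →
    ∀ (k : ℕ) (a b : ℚ) (P : Fin k → Fin 3 → Fin 2 → Polynomial ℚ) (k' : ℕ) (a' b' : ℚ)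
      (P' : Fin k' → Fin 3 → Fin 2 → Polynomial ℚ) (r r' : KZ.IntegralRep 3),
      a < b →
      (∀ i, ∀ t ∈ Set.Ioo (a : ℝ) b,
          (Polynomial.aeval t (P i 1 0) - Polynomial.aeval t (P i 0 0)) *
          (Polynomial.aeval t (P i 2 1) - Polynomial.aeval t (P i 0 1)) -
        (Polynomial.aeval t (P i 1 1) - Polynomial.aeval t (P i 0 1)) *
          (Polynomial.aeval t (P i 2 0) - Polynomial.aeval t (P i 0 0)) ≠ 0) →
      (∀ i i', i ≠ i' → Disjoint
        {p : Fin 3 → ℝ | p 0 ∈ Set.Ioo (a : ℝ) b ∧ ∃ l m : ℝ, 0 < l ∧ 0 < m ∧ l + m < 1 ∧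
          p 1 = Polynomial.aeval (p 0) (P i 0 0) + l * (Polynomial.aeval (p 0) (P i 1 0) - Polynomial.aeval (p 0) (P i 0 0)) +
            m * (Polynomial.aeval (p 0) (P i 2 0) - Polynomial.aeval (p 0) (P i 0 0)) ∧
          p 2 = Polynomial.aeval (p 0) (P i 0 1) + l * (Polynomial.aeval (p 0) (P i 1 1) - Polynomial.aeval (p 0) (P i 0 1)) +
            m * (Polynomial.aeval (p 0) (P i 2 1) - Polynomial.aeval (p 0) (P i 0 1))}
        {p : Fin 3 → ℝ | p 0 ∈ Set.Ioo (a : ℝ) b ∧ ∃ l m : ℝ, 0 < l ∧ 0 < m ∧ l + m < 1 ∧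
          p 1 = Polynomial.aeval (p 0) (P i' 0 0) + l * (Polynomial.aeval (p 0) (P i' 1 0) - Polynomial.aeval (p 0) (P i' 0 0)) +
            m * (Polynomial.aeval (p 0) (P i' 2 0) - Polynomial.aeval (p 0) (P i' 0 0)) ∧
          p 2 = Polynomial.aeval (p 0) (P i' 0 1) + l * (Polynomial.aeval (p 0) (P i' 1 1) - Polynomial.aeval (p 0) (P i' 0 1)) +
            m * (Polynomial.aeval (p 0) (P i' 2 1) - Polynomial.aeval (p 0) (P i' 0 1))}) →
      r.domain = ⋃ i, {p : Fin 3 → ℝ | p 0 ∈ Set.Ioo (a : ℝ) b ∧ ∃ l m : ℝ, 0 < l ∧ 0 < m ∧ l + m < 1 ∧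
          p 1 = Polynomial.aeval (p 0) (P i 0 0) + l * (Polynomial.aeval (p 0) (P i 1 0) - Polynomial.aeval (p 0) (P i 0 0)) +
            m * (Polynomial.aeval (p 0) (P i 2 0) - Polynomial.aeval (p 0) (P i 0 0)) ∧
          p 2 = Polynomial.aeval (p 0) (P i 0 1) + l * (Polynomial.aeval (p 0) (P i 1 1) - Polynomial.aeval (p 0) (P i 0 1)) +
            m * (Polynomial.aeval (p 0) (P i 2 1) - Polynomial.aeval (p 0) (P i 0 1))} →
      (∀ p ∈ r.domain, r.integrand p = 1) →
      a' < b' →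
      (∀ i, ∀ t ∈ Set.Ioo (a' : ℝ) b',
          (Polynomial.aeval t (P' i 1 0) - Polynomial.aeval t (P' i 0 0)) *
          (Polynomial.aeval t (P' i 2 1) - Polynomial.aeval t (P' i 0 1)) -
        (Polynomial.aeval t (P' i 1 1) - Polynomial.aeval t (P' i 0 1)) *
          (Polynomial.aeval t (P' i 2 0) - Polynomial.aeval t (P' i 0 0)) ≠ 0) →
      (∀ i i', i ≠ i' → Disjoint
        {p : Fin 3 → ℝ | p 0 ∈ Set.Ioo (a' : ℝ) b' ∧ ∃ l m : ℝ, 0 < l ∧ 0 < m ∧ l + m < 1 ∧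
          p 1 = Polynomial.aeval (p 0) (P' i 0 0) + l * (Polynomial.aeval (p 0) (P' i 1 0) - Polynomial.aeval (p 0) (P' i 0 0)) +
            m * (Polynomial.aeval (p 0) (P' i 2 0) - Polynomial.aeval (p 0) (P' i 0 0)) ∧
          p 2 = Polynomial.aeval (p 0) (P' i 0 1) + l * (Polynomial.aeval (p 0) (P' i 1 1) - Polynomial.aeval (p 0) (P' i 0 1)) +
            m * (Polynomial.aeval (p 0) (P' i 2 1) - Polynomial.aeval (p 0) (P' i 0 1))}
        {p : Fin 3 → ℝ | p 0 ∈ Set.Ioo (a' : ℝ) b' ∧ ∃ l m : ℝ, 0 < l ∧ 0 < m ∧ l + m < 1 ∧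
          p 1 = Polynomial.aeval (p 0) (P' i' 0 0) + l * (Polynomial.aeval (p 0) (P' i' 1 0) - Polynomial.aeval (p 0) (P' i' 0 0)) +
            m * (Polynomial.aeval (p 0) (P' i' 2 0) - Polynomial.aeval (p 0) (P' i' 0 0)) ∧
          p 2 = Polynomial.aeval (p 0) (P' i' 0 1) + l * (Polynomial.aeval (p 0) (P' i' 1 1) - Polynomial.aeval (p 0) (P' i' 0 1)) +
            m * (Polynomial.aeval (p 0) (P' i' 2 1) - Polynomial.aeval (p 0) (P' i' 0 1))}) →
      r'.domain = ⋃ i, {p : Fin 3 → ℝ | p 0 ∈ Set.Ioo (a' : ℝ) b' ∧ ∃ l m : ℝ, 0 < l ∧ 0 < m ∧ l + m < 1 ∧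
          p 1 = Polynomial.aeval (p 0) (P' i 0 0) + l * (Polynomial.aeval (p 0) (P' i 1 0) - Polynomial.aeval (p 0) (P' i 0 0)) +
            m * (Polynomial.aeval (p 0) (P' i 2 0) - Polynomial.aeval (p 0) (P' i 0 0)) ∧
          p 2 = Polynomial.aeval (p 0) (P' i 0 1) + l * (Polynomial.aeval (p 0) (P' i 1 1) - Polynomial.aeval (p 0) (P' i 0 1)) +
            m * (Polynomial.aeval (p 0) (P' i 2 1) - Polynomial.aeval (p 0) (P' i 0 1))} →
      (∀ p ∈ r'.domain, r'.integrand p = 1) →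
      r.value = r'.value → KZ.Equivalent r r' := by
  intro hP hH k a b P k' a' b' P' r r' hab hdet hdisj hdom h1 hab' hdet' hdisj' hdom' h1' hv
  obtain ⟨Q, s, hQ, hsd, hs1, hrs⟩ := hH k a b P r hab hdet hdisj hdom h1
  obtain ⟨Q', s', hQ', hsd', hs1', hrs'⟩ := hH k' a' b' P' r' hab' hdet' hdisj' hdom' h1'
  obtain ⟨G, hG⟩ := polyUnc_exists_derivative_eq Q
  obtain ⟨G', hG'⟩ := polyUnc_exists_derivative_eq Q'
  obtain ⟨c, hcd, hci, hsc⟩ := hP a b (fun t => Polynomial.aeval t Q) (fun t => Polynomial.aeval t G)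
    s hab (polyUnc_isSemialgebraicFunOn_aeval (polyUnc_isSemialgebraic_Ioo a b) Q)
    (polyUnc_isSemialgebraicFunOn_aeval (polyUnc_isSemialgebraic_Icc a b) G)
    (Polynomial.continuous_aeval G).continuousOn
    (fun t _ => by simpa only [hG] using Polynomial.hasDerivAt_aeval G t) hQ hsd hs1
  obtain ⟨c', hcd', hci', hsc'⟩ := hP a' b' (fun t => Polynomial.aeval t Q')
    (fun t => Polynomial.aeval t G') s' hab'
    (polyUnc_isSemialgebraicFunOn_aeval (polyUnc_isSemialgebraic_Ioo a' b') Q')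
    (polyUnc_isSemialgebraicFunOn_aeval (polyUnc_isSemialgebraic_Icc a' b') G')
    (Polynomial.continuous_aeval G').continuousOn
    (fun t _ => by simpa only [hG'] using Polynomial.hasDerivAt_aeval G' t) hQ' hsd' hs1'
  -- the two constants are the two (equal) volumes
  have hvc : c.value = Polynomial.aeval (b : ℝ) G - Polynomial.aeval (a : ℝ) G :=
    polyUnc_value_eq_const c hcd hci
  have hvc' : c'.value = Polynomial.aeval (b' : ℝ) G' - Polynomial.aeval (a' : ℝ) G' :=
    polyUnc_value_eq_const c' hcd' hci'
  have hcc : c.value = c'.value := by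
    rw [← KZ.Equivalent.value_eq_holds hsc, ← KZ.Equivalent.value_eq_holds hrs, hv,
      KZ.Equivalent.value_eq_holds hrs', KZ.Equivalent.value_eq_holds hsc']
  -- two point representations with the same constant differ by a relation
  have hcc' : KZ.Equivalent c c' :=
    KZ.of_sub_of_mem_relations_of_eqOn (by rw [hcd, hcd']) fun x _ => by
      rw [hci, hci', ← hvc, ← hvc', hcc]
  exact hrs.trans (hsc.trans (hcc'.trans (hsc'.symm.trans hrs'.symm)))

end Summit.KontsevichZagierPeriods.SymplecticScissors.VolumeForm

end
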